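import Summits.NavierStokesRegularity.NavierStokesRegularity.Theorems.NoOverheating.Negative.ExcludedStrataCensusV17
import Summits.NavierStokesRegularity.NavierStokesRegularity.Theorems.NoOverheating.Negative.IrrotationalNonlinearityWindowsExcluded

/-!
# KJ-72b — CENSUS v18 of the excluded strata of route `AngularGalerkinLadder`'s window sequences
# ((S0)–(S31a) of `excludedStrata_windowSequences_v17` + the LAMB-VECTOR strata of circuit g12's
# `IrrotationalNonlinearityWindowsExcluded` (p565326): (S32) the self-advection becomes WEAKLY a
# gradient along the sequence, (S32′) one member whose self-advection is rung-invisible —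
# co-band-limited modulo a smooth gradient — at every time)

Refuter lineage, Negative lane of crux K2 `NoOverheating` (supports, does not decide).  Pure
assembly — this file proves NOTHING new: it folds the ACCEPTED kernel file
`IrrotationalNonlinearityWindowsExcluded` (seat `ns-blowup-circuit` g12; addressed to the census
pen at STATUS l.10565 with the two W-clauses below, not folded by v12–v17) into the census statement
of record, `excludedStrata_windowSequences_v18`, "what an admissible window sequence of K2 can NOT
be":

* (S32) (W-b, sequence level) for every `t < 0` and every smooth, compactly supported,
  divergence-free test field `φ`, `∫ ⟪(uₙ(t)·∇)uₙ(t), φ⟫ → 0`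
  (`…IrrotationalNonlinearityWindowsExcluded.no_windowSequence_weaklyIrrotationalNonlinearity`:
  the trilinear form passes to the Type-I ladder limit `v` by integration by parts and dominated
  convergence, `v` solves the STOKES system classically after pressure reconstruction, and the
  ancient Stokes Liouville theorem with the Type-I bound kills it — against the floor `δ`).  Since
  gradients are `L²`-orthogonal to solenoidal tests, (S32) reads: the LAMB VECTOR `ωₙ × uₙ` tends
  to zero weakly modulo gradients; it contains every sequence whose limit is irrotational,
  Beltrami, or has gradient self-advection.
* (S32′) (W-a, one member) for some index `n` and every `t < 0` there is a smooth `q` with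
  `(uₙ(t)·∇)uₙ(t) + ∇q` co-band-limited at level `Lₙ` — the rung does not see its own
  self-advection (`…no_windowProfile_convect_coband`, via circuit's
  `NonlinearityLoadBearing.rungProfile_eq_zero_of_convect_coband`: the profile then solves the
  LINEAR rung system, which has no Type-I ancient band-limited solution).

Census sentence after v18: as v17, AND (nonlinearity) the band-visible self-advection of an
admissible supply is LOAD-BEARING at some time in every member, and its solenoidal part (the Lamb
vector modulo gradients) does not die weakly along the ladder.
[cite: KochNadirashviliSereginSverak2009, Lemma 3.1 and Lemma 6.1 (limits of rescaled solutions)] -/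

namespace Summit.NavierStokesRegularity.AngularGalerkinLadderExcludedStrataCensusV18

open Set Filter MeasureTheory Topology Function
open scoped ENNReal RealInnerProductSpace ContDiff
open Literature.Analysis Literature.Analysis.FluidPDE
open Summit.NavierStokesRegularity.FluidComputer
open Summit.NavierStokesRegularity.NavierStokesRegularity.Theses.AngularGalerkinLadder
open Summit.NavierStokesRegularity.AngularGalerkinLadderExcludedStrataCensusV17
open Summit.NavierStokesRegularity.AngularGalerkinLadderIrrotationalNonlinearityWindowsExcluded

/-- **Census theorem v18: the excluded strata (S0)–(S32′) of K2's window sequences.**  As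
`excludedStrata_windowSequences_v17`, plus the Lamb-vector strata: (S32) for every `t < 0` and every
smooth compactly supported divergence-free `φ`, `∫ ⟪(uₙ(t)·∇)uₙ(t), φ⟫ → 0`; (S32′) some member
whose self-advection is co-band-limited modulo a smooth gradient at every `t < 0` — for ANY `C₀`,
ANY window and ANY rotations.
[cite: KochNadirashviliSereginSverak2009, Lemma 3.1 and Lemma 6.1 (limits of rescaled solutions)] -/
theorem excludedStrata_windowSequences_v18 :
    ∃ ε₀ : ℝ, 0 < ε₀ ∧ ∀ C₀ : ℝ, ∃ κ α₁ c₁ α₂ c₂ lam₁ β₁ β₂ lam₂ : ℝ,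
      1 < κ ∧ 0 < α₁ ∧ 1 < c₁ ∧ 0 < α₂ ∧ 1 < c₂ ∧ 1 < lam₁ ∧ 0 < β₁ ∧ 0 < β₂ ∧ 1 < lam₂ ∧
      ∀ {cmin cmax δ : ℝ} {L : ℕ → ℕ} {ε c : ℕ → ℝ}
        {R : ℕ → (EuclideanSpace ℝ (Fin 3) ≃ₗᵢ[ℝ] EuclideanSpace ℝ (Fin 3))}
        {u : ℕ → ℝ → EuclideanSpace ℝ (Fin 3) → EuclideanSpace ℝ (Fin 3)}
        {p : ℕ → ℝ → EuclideanSpace ℝ (Fin 3) → ℝ}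
        {d : ℕ → ℝ → EuclideanSpace ℝ (Fin 3) → EuclideanSpace ℝ (Fin 3)},
        1 < cmin → 0 < δ → Tendsto ε atTop (𝓝 0) →
        (∀ n, AngularLadder.IsWindowProfile (L n) C₀ cmin cmax δ (ε n) (c n) (R n) (u n) (p n)
          (d n)) →
        ¬ (C₀ ≤ ε₀ ∨
           (∀ n, ∀ t < 0, IsAxisymmetric (u n t)) ∨
           (∃ q : ℕ, 0 < q ∧ cmax ^ q < κ ∧
              ∀ x, Tendsto (fun n => ((R n) ^ q) x) atTop (𝓝 x)) ∨
           (∃ (q : ℕ) (g : ℕ → (EuclideanSpace ℝ (Fin 3) ≃ₗᵢ[ℝ] EuclideanSpace ℝ (Fin 3)))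
              (θ : ℕ → ℝ),
              0 < q ∧ cmax ^ q < c₁ ∧ (∀ n x, ((R n) ^ q) x = g n (rotZ (θ n) ((g n).symm x))) ∧
              ∀ n, |θ n| ≤ 2 * α₁ * (q * Real.log (c n))) ∨
           (∃ (Θ ℓ : ℝ) (g : ℕ → (EuclideanSpace ℝ (Fin 3) ≃ₗᵢ[ℝ] EuclideanSpace ℝ (Fin 3)))
              (θ : ℕ → ℝ),
              ℓ < Real.log c₂ ∧ (∀ n x, R n x = g n (rotZ (θ n) ((g n).symm x))) ∧
              (∀ n, |θ n| ≤ Θ) ∧ (∀ n, 2 * α₂ * Real.log (c n) ≤ |θ n|) ∧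
              ∀ n, (1 + (θ n / (2 * Real.log (c n))) ^ 2) * Real.log (c n) ≤ ℓ) ∨
           (∃ lam : ℝ, 1 < lam ∧ lam < lam₁ ∧ ∀ n, IsDiscretelySelfSimilar lam (u n)) ∨
           (∀ n, IsSelfSimilar (u n)) ∨
           (∃ (g : ℕ → (EuclideanSpace ℝ (Fin 3) ≃ₗᵢ[ℝ] EuclideanSpace ℝ (Fin 3))) (α : ℕ → ℝ),
              (∀ n (μ : ℝ), 1 < μ → IsRotatedDSS μ
                (((g n).symm.trans (rotZLIE (2 * α n * Real.log μ))).trans (g n)) (u n)) ∧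
              ∀ n, |α n| ≤ β₁ ∨ β₂ ≤ |α n|) ∨
           (∃ M : ℝ≥0∞, M < ⊤ ∧ ∀ n, eLpNorm (u n (-1)) 3 volume ≤ M) ∨
           (∃ M : ℝ≥0∞, M < ⊤ ∧ ∀ n, eLpNorm (u n (-1)) 2 volume ≤ M) ∨
           (∀ η : ℝ, 0 < η → ∃ ρ : ℝ, ∀ n x, ρ ≤ ‖x‖ → ‖x‖ * ‖u n (-1) x‖ ≤ η) ∨
           (∀ n, ∀ t < 0, ∃ e : EuclideanSpace ℝ (Fin 3), ∀ x,
              curl (u n t) x = ‖curl (u n t) x‖ • e) ∨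
           (∀ n, ∃ (d₀ : ℝ) (η : ℝ → ℝ), Tendsto η (𝓝[>] 0) (𝓝 0) ∧
              ∀ s ∈ Ioo (-1 : ℝ) 0, ∀ x y, d₀ < ‖curl (u n s) x‖ → d₀ < ‖curl (u n s) y‖ →
                ‖vorticityDirection (curl (u n s)) x - vorticityDirection (curl (u n s)) y‖ ≤
                  η ‖x - y‖) ∨
           (∃ (n : ℕ) (S : EuclideanSpace ℝ (Fin 3) ≃ₗᵢ[ℝ] EuclideanSpace ℝ (Fin 3))
              (b : EuclideanSpace ℝ (Fin 3)), S b = b ∧ b ≠ 0 ∧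
              ∀ x, ‖u n (-1) (S x + b)‖ = ‖u n (-1) x‖) ∨
           (∃ (n : ℕ) (ρ B : ℝ), 0 < ρ ∧
              ∀ z ∈ parabolicCylinder ρ (0 : ℝ × EuclideanSpace ℝ (Fin 3)), ‖u n z.1 z.2‖ ≤ B) ∨
           (∃ (n : ℕ) (U : EuclideanSpace ℝ (Fin 3) → EuclideanSpace ℝ (Fin 3)),
              Continuous U ∧ ∀ t < 0, u n t = U) ∨
           (∃ (n : ℕ) (e : EuclideanSpace ℝ (Fin 3)), ∀ x, ∃ a : ℝ,
              curl (u n (-1)) x = a • e) ∨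
           (∃ (n : ℕ) (d₀ : ℝ) (η : ℝ → ℝ), Tendsto η (𝓝[>] 0) (𝓝 0) ∧
              ∀ s ∈ Ioo (-1 : ℝ) 0, ∀ x y, d₀ < ‖curl (u n s) x‖ → d₀ < ‖curl (u n s) y‖ →
                min ‖vorticityDirection (curl (u n s)) x - vorticityDirection (curl (u n s)) y‖
                    ‖vorticityDirection (curl (u n s)) x + vorticityDirection (curl (u n s)) y‖ ≤
                  η ‖x - y‖) ∨
           (∃ (n : ℕ) (ρ M : ℝ), 0 < ρ ∧
              ∀ z ∈ parabolicCylinder ρ (0 : ℝ × EuclideanSpace ℝ (Fin 3)),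
                ‖curl (u n z.1) z.2‖ ≤ M) ∨
           (∃ (n : ℕ) (e : EuclideanSpace ℝ (Fin 3)) (ρ M : ℝ), (R n e = e ∨ R n e = -e) ∧
              0 < ρ ∧ ∀ z ∈ parabolicCylinder ρ (0 : ℝ × EuclideanSpace ℝ (Fin 3)),
                ∃ a : ℝ, ‖u n z.1 z.2 - a • e‖ ≤ M) ∨
           (∃ (n : ℕ) (e : EuclideanSpace ℝ (Fin 3)) (ρ M : ℝ), (R n e = e ∨ R n e = -e) ∧
              0 < ρ ∧ ∀ z ∈ parabolicCylinder ρ (0 : ℝ × EuclideanSpace ℝ (Fin 3)),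
                ∃ a : ℝ, ‖curl (u n z.1) z.2 - a • e‖ ≤ M) ∨
           (∃ (n : ℕ) (S : EuclideanSpace ℝ (Fin 3) ≃ₗᵢ[ℝ] EuclideanSpace ℝ (Fin 3))
              (b : EuclideanSpace ℝ (Fin 3)), S b = b ∧ b ≠ 0 ∧
              ∀ x, ‖u n (-1) x‖ ≤ ‖u n (-1) (S x + b)‖) ∨
           (∃ A : ℕ → (EuclideanSpace ℝ (Fin 3) ≃ₗᵢ[ℝ] EuclideanSpace ℝ (Fin 3)),
              ∀ θ, ∀ t < 0, ∀ x,
                Tendsto (fun n => (A n).symm (u n t (A n (rotZ θ x))) -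
                  rotZ θ ((A n).symm (u n t (A n x)))) atTop (𝓝 0)) ∨
           (∃ (S : EuclideanSpace ℝ (Fin 3) ≃ₗᵢ[ℝ] EuclideanSpace ℝ (Fin 3))
              (b : EuclideanSpace ℝ (Fin 3)), S b = b ∧ b ≠ 0 ∧
              ∀ x, Tendsto (fun n => ‖u n (-1) (S x + b)‖ - ‖u n (-1) x‖) atTop (𝓝 0)) ∨
           (∀ s < 0, ∀ t < 0, ∀ x, Tendsto (fun n => u n t x - u n s x) atTop (𝓝 0)) ∨
           (∃ (A : ℕ → (EuclideanSpace ℝ (Fin 3) ≃ₗᵢ[ℝ] EuclideanSpace ℝ (Fin 3))) (α : ℕ → ℝ),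
              Tendsto α atTop (𝓝 0) ∧ (∀ n, α n ≠ 0) ∧ ∀ n, ∀ t < 0, ∀ x,
                (A n).symm (u n t (A n (rotZ (α n) x))) =
                  rotZ (α n) ((A n).symm (u n t (A n x)))) ∨
           (∃ σ : ℕ → ℝ, (∀ n, 1 < σ n) ∧ Tendsto σ atTop (𝓝 1) ∧
              ∀ n, IsDiscretelySelfSimilar (σ n) (u n)) ∨
           (∃ lam : ℝ, 1 < lam ∧ lam < lam₂ ∧ ∀ t < 0, ∀ x,
              Tendsto (fun n => lam • u n (lam ^ 2 * t) (lam • x) - u n t x) atTop (𝓝 0)) ∨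
           (∃ (n : ℕ) (τ : ℝ), 0 < τ ∧ ∀ t < 0, ∀ x, u n (t - τ) x = u n t x) ∨
           (∃ (τ : ℕ → ℝ) (τ₀ : ℝ), 0 < τ₀ ∧ Tendsto τ atTop (𝓝 τ₀) ∧
              ∀ t < 0, ∀ x, Tendsto (fun n => u n (t - τ n) x - u n t x) atTop (𝓝 0)) ∨
           (∃ (n : ℕ) (U : EuclideanSpace ℝ (Fin 3) → EuclideanSpace ℝ (Fin 3))
              (b : EuclideanSpace ℝ (Fin 3)), ∀ t < 0, ∀ x, u n t x = U (x - t • b)) ∨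
           (∃ b : EuclideanSpace ℝ (Fin 3), ∀ s < 0, ∀ t < 0, ∀ x,
              Tendsto (fun n => u n t (x + t • b) - u n s (x + s • b)) atTop (𝓝 0)) ∨
           (∃ n : ℕ, ∀ lam : ℝ, 0 < lam → lam < 1 → ∀ x,
              lam • u n (-1) (lam • x) = u n (-1) x) ∨
           (∀ lam : ℝ, 0 < lam → lam < 1 → ∀ x,
              Tendsto (fun n => lam • u n (-1) (lam • x) - u n (-1) x) atTop (𝓝 0)) ∨
           (∃ (n : ℕ) (g : ℝ → (EuclideanSpace ℝ (Fin 3) ≃ₗᵢ[ℝ] EuclideanSpace ℝ (Fin 3))),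
              ∀ s < 0, ∀ t < 0, ∀ x, ‖u n s (g s x)‖ = ‖u n t (g t x)‖) ∨
           (∃ g : ℝ → (EuclideanSpace ℝ (Fin 3) ≃ₗᵢ[ℝ] EuclideanSpace ℝ (Fin 3)),
              ∀ s < 0, ∀ t < 0, ∀ x,
                Tendsto (fun n => ‖u n s (g s x)‖ - ‖u n t (g t x)‖) atTop (𝓝 0)) ∨
           (∃ (n : ℕ) (lam : ℝ), 0 < lam ∧ lam < 1 ∧ ∀ x,
              lam • u n (-1) (lam • x) = u n (-1) x) ∨
           (∃ lam : ℝ, 0 < lam ∧ lam < 1 ∧ ∀ x,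
              Tendsto (fun n => lam • u n (-1) (lam • x) - u n (-1) x) atTop (𝓝 0)) ∨
           (∃ (n : ℕ) (lam μ : ℝ), 0 < lam ∧ lam < 1 ∧ ∀ x,
              μ • u n (-1) (lam • x) = u n (-1) x) ∨
           (∃ lam μ : ℝ, 0 < lam ∧ lam < 1 ∧ ∀ x,
              Tendsto (fun n => μ • u n (-1) (lam • x) - u n (-1) x) atTop (𝓝 0)) ∨
           (∃ σ : EuclideanSpace ℝ (Fin 3) ≃ₗᵢ[ℝ] EuclideanSpace ℝ (Fin 3),
              ∀ t < 0, ∀ x, Tendsto (fun n => σ (u n t (σ.symm x)) + u n t x) atTop (𝓝 0)) ∨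
           (∀ t < 0, ∀ x, Tendsto (fun n => u n t x - u n t (-x)) atTop (𝓝 0)) ∨
           (∀ t < 0, ∀ φ : EuclideanSpace ℝ (Fin 3) → EuclideanSpace ℝ (Fin 3),
              ContDiff ℝ ∞ φ → HasCompactSupport φ → VectorCalculus.IsDivFree φ →
                Tendsto (fun n => ∫ x, ⟪convect (u n t) (u n t) x, φ x⟫) atTop (𝓝 0)) ∨
           (∃ n : ℕ, ∀ t < 0, ∃ q : EuclideanSpace ℝ (Fin 3) → ℝ, ContDiff ℝ ∞ q ∧
              AngularLadder.IsCobandLimited (L n) fun x =>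
                convect (u n t) (u n t) x + gradient q x)) := by
  obtain ⟨ε₀, hε₀, H⟩ := excludedStrata_windowSequences_v17
  refine ⟨ε₀, hε₀, fun C₀ => ?_⟩
  obtain ⟨κ, α₁, c₁, α₂, c₂, lam₁, β₁, β₂, lam₂, hκ, hα₁, hc₁, hα₂, hc₂, hlam₁, hβ₁, hβ₂, hlam₂,
    HC⟩ := H C₀
  refine ⟨κ, α₁, c₁, α₂, c₂, lam₁, β₁, β₂, lam₂, hκ, hα₁, hc₁, hα₂, hc₂, hlam₁, hβ₁, hβ₂, hlam₂,
    fun {cmin cmax δ L ε c R u p d} hcmin hδ hε hW => ?_⟩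
  have HC' := HC hcmin hδ hε hW
  simp only [not_or] at HC' ⊢
  obtain ⟨h0, h1, h2, h3, h4, h5, h6, h7, h8, h9, h10, h11, h12, h13, h14, h15, h16, h17, h18, h19,
    h20, h21, h22, h23, h24, h25, h26, h27, h28, h29, h30, h31, h32, h33, h34, h35, h36, h37, h38,
    h39, h40, h41⟩ := HC'
  exact ⟨h0, h1, h2, h3, h4, h5, h6, h7, h8, h9, h10, h11, h12, h13, h14, h15, h16, h17, h18, h19,
    h20, h21, h22, h23, h24, h25, h26, h27, h28, h29, h30, h31, h32, h33, h34, h35, h36, h37, h38,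
    h39, h40, h41, fun h => no_windowSequence_weaklyIrrotationalNonlinearity hcmin hδ hε hW h,
    fun ⟨n, hinv⟩ => no_windowProfile_convect_coband (hW n) hδ hinv⟩

end Summit.NavierStokesRegularity.AngularGalerkinLadderExcludedStrataCensusV18
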